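import Mathlib.FieldTheory.IntermediateField.Adjoin.Basic
import Mathlib.RingTheory.Flat.Localization
import Mathlib.RingTheory.Flat.Stability
import Mathlib.RingTheory.Ideal.GoingDown
import Mathlib.RingTheory.Ideal.KrullsHeightTheorem
import Mathlib.RingTheory.Localization.LocalizationLocalization
import Mathlib.RingTheory.Unramified.LocalRing
import Literature.NumberTheory.GaloisRepresentations.CrystallineDeformationRingSmooth
import HarnessLib

/-!
# Kisin / BLGGT §1.4: a regular generic fibre has every point on a unique component (proofs)

Trunk: GaloisRepresentations (provefact `Kisin2007_crystallineDeformationRings` of the file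
`CrystallineDeformationRingSmooth`; this sibling file holds PROVED steps of the published
argument, no definitions and no named facts).

## Mathematics

[BLGGT] §1.4 (p. 14 of arXiv:1010.2561): "'Connects' is an equivalence relation. (Because
`R^□_{𝒪,ρ̄_i,{H_τ},K'-cris}[1/l]` is formally smooth.)" — i.e. the last conjunct
`CrystallinePointsOnUniqueComponent` of the named fact `Kisin2007_crystallineDeformationRings`
(every `ℚ̄_p`-point of `Spec (ℚ̄_p ⊗_{𝒪_L} R)` lies on a unique irreducible component) is a
CONSEQUENCE of the previous one, `CrystallineGenericFibreRegular` (Kisin 2008, Thm. (3.3.8):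
`R[1/p]` is a regular ring). The commutative algebra making this precise, proved here:

* `isRegularLocalRing_localization_of_isUnramifiedAt`, `isRegularRing_of_flat_of_formallyUnramified`:
  regularity ascends along flat, formally unramified, essentially-finite-type ring maps from a
  ring that is regular after inverting a submonoid `M` whose elements become units upstairs —
  Matsumura, *Commutative Ring Theory*, Thm. 23.7 (ii) ("`A → B` flat local, `A` and `F = B/𝔪B`
  regular ⇒ `B` regular") in the case where the closed fibre `F` is a field (unramified), with
  the dimension inequality from going-down (Mathlib `Ideal.height_eq_height_add_of_liesOver_of_hasGoingDown`)
  and `𝔭B_𝔓 = 𝔓B_𝔓` from Mathlib `Algebra.isUnramifiedAt_iff_map_eq`.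
* `isRegularRing_tensorProduct_intermediateField`: for `L = Frac 𝒪` of characteristic zero,
  `E/L` a field extension, `R` a noetherian `𝒪`-algebra with `R[1/o]` regular (`o ∈ 𝒪` non-zero
  in `L`), and `L'/L` finite inside `E`, the ring `R ⊗_𝒪 L'` is regular.
* `isDomain_localization_atPrime_tensorProduct`: under the same hypotheses with `E/L` algebraic,
  every local ring of `E ⊗_𝒪 R` is a domain (`E ⊗_𝒪 R = ⋃_{L'} R ⊗_𝒪 L'`, each regular, and
  regular local rings are domains — the tree's `isDomain_of_isRegularLocalRing`, Matsumura
  Thm. 14.3); `E ⊗_𝒪 R` itself is in general not noetherian.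
* `PstWeilDeligneData.CrystallineGenericFibreRegular.crystallinePointsOnUniqueComponent`:
  `CrystallineGenericFibreRegular 𝔇 → CrystallinePointsOnUniqueComponent 𝔇`, and the reduction
  `kisin2007_crystallineDeformationRings_of_crystallineGenericFibreRegular` of the named fact to
  its first four conjuncts (existence of the genuine datum with Kisin's properties).

## References

* T. Barnet-Lamb, T. Gee, D. Geraghty, R. Taylor, *Potential automorphy and change of weight*,
  Ann. of Math. 179 (2014), §1.3–1.4 (pp. 12–14 of arXiv:1010.2561). [BarnetlambEtAl2014]
* M. Kisin, *Potentially semi-stable deformation rings*, J. Amer. Math. Soc. 21 (2008), 513–546,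
  Thm. (3.3.8). [Kisin2007]
* H. Matsumura, *Commutative Ring Theory* (CUP 1986), Thm. 14.3, Thm. 23.7. [Matsumura1987]
-/

noncomputable section

open scoped TensorProduct
open Field IsLocalRing

namespace Literature.NumberTheory.GaloisRepresentations

/-! ### Commutative algebra: regularity ascends along unramified flat maps -/

section EtaleRegular

variable {R B : Type*} [CommRing R] [CommRing B] [Algebra R B]

/-- **Unramified + going-down over a regular local base ⇒ regular.** Let `B` be a noetherian
`R`-algebra, essentially of finite type and satisfying going-down (e.g. flat), let `𝔓` be a prime
of `B` at which `B` is unramified over `R`, lying over `𝔭`, and assume `R_𝔭` is a regular local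
ring. Then `B_𝔓` is a regular local ring: its maximal ideal is `𝔭B_𝔓` (Mathlib
`Algebra.isUnramifiedAt_iff_map_eq`), generated by `dim R_𝔭` elements, and
`dim R_𝔭 = ht 𝔭 ≤ ht 𝔓 = dim B_𝔓` by going-down. This is Matsumura's Thm. 23.7 (ii) ("if `A`
and `F = B/𝔪B` are regular then so is `B`") in the case where the closed fibre `F` is a field.
[cite: Matsumura1987, Thm. 23.7] -/
theorem isRegularLocalRing_localization_of_isUnramifiedAt [IsNoetherianRing R]
    [IsNoetherianRing B] [Algebra.HasGoingDown R B] [Algebra.EssFiniteType R B] (P : Ideal B) [P.IsPrime]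
    [Algebra.IsUnramifiedAt R P] [IsRegularLocalRing (Localization.AtPrime (P.under R))] :
    IsRegularLocalRing (Localization.AtPrime P) := by
  haveI : P.LiesOver (P.under R) := ⟨rfl⟩
  letI := Localization.AtPrime.algebraOfLiesOver (P.under R) P
  obtain ⟨-, hmap⟩ := (Algebra.isUnramifiedAt_iff_map_eq R (P.under R) P).mp ‹_›
  apply IsRegularLocalRing.of_spanFinrank_maximalIdeal_le
  have h1 : maximalIdeal (Localization.AtPrime P) =
      (maximalIdeal (Localization.AtPrime (P.under R))).map
        (algebraMap (Localization.AtPrime (P.under R)) (Localization.AtPrime P)) := by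
    conv_rhs => rw [← Localization.AtPrime.map_eq_maximalIdeal, Ideal.map_map,
      ← IsScalarTower.algebraMap_eq]
    exact hmap.symm
  have h2 : (maximalIdeal (Localization.AtPrime P)).spanFinrank ≤
      (maximalIdeal (Localization.AtPrime (P.under R))).spanFinrank := by
    rw [h1]
    exact Ideal.spanFinrank_map_le_of_fg _ (IsNoetherian.noetherian _)
  have h3 : ((maximalIdeal (Localization.AtPrime (P.under R))).spanFinrank : WithBot ℕ∞) =
      ringKrullDim (Localization.AtPrime (P.under R)) :=
    IsRegularLocalRing.spanFinrank_maximalIdeal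
  have h4 : ringKrullDim (Localization.AtPrime (P.under R)) = (P.under R).height :=
    IsLocalization.AtPrime.ringKrullDim_eq_height (P.under R) _
  have h5 : ringKrullDim (Localization.AtPrime P) = P.height :=
    IsLocalization.AtPrime.ringKrullDim_eq_height P _
  have h6 : (P.under R).height ≤ P.height := by
    rw [Ideal.height_eq_height_add_of_liesOver_of_hasGoingDown (P.under R) P]
    exact le_self_add
  calc ((maximalIdeal (Localization.AtPrime P)).spanFinrank : WithBot ℕ∞)
      ≤ (maximalIdeal (Localization.AtPrime (P.under R))).spanFinrank := by exact_mod_cast h2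
    _ = (P.under R).height := h3.trans h4
    _ ≤ P.height := by exact_mod_cast h6
    _ = ringKrullDim (Localization.AtPrime P) := h5.symm

/-- **Regularity ascends along flat unramified essentially-finite-type maps from a ring that is
regular after inverting `M`.** Let `A = M⁻¹R` be a regular ring (Mathlib `IsRegularRing`) and `B`
a noetherian `R`-algebra which is flat, formally unramified and essentially of finite type over
`R` and in which the elements of `M` become units. Then `B` is a regular ring: every prime `𝔓` of
`B` lies over a prime `𝔭` of `R` disjoint from `M`, so `R_𝔭 = A_{𝔭A}` is regular local and
`isRegularLocalRing_localization_of_isUnramifiedAt` applies. (For `M = 1`: flat unramified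
essentially-finite-type algebras over regular rings are regular.) [cite: Matsumura1987, Thm. 23.7] -/
theorem isRegularRing_of_flat_of_formallyUnramified [IsNoetherianRing R] [IsNoetherianRing B]
    [Module.Flat R B] [Algebra.FormallyUnramified R B] [Algebra.EssFiniteType R B]
    (M : Submonoid R) (A : Type*) [CommRing A] [Algebra R A] [IsLocalization M A]
    [IsRegularRing A] (hM : ∀ m ∈ M, IsUnit (algebraMap R B m)) : IsRegularRing B := by
  rw [isRegularRing_iff]
  intro P _
  have hdisj : Disjoint (M : Set R) (P.under R) := by
    rw [Set.disjoint_left]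
    intro m hm hm'
    exact (Ideal.IsPrime.ne_top ‹P.IsPrime›)
      (P.eq_top_of_isUnit_mem (Ideal.mem_comap.mp hm') (hM m hm))
  haveI : IsRegularRing (Localization M) :=
    IsRegularRing.of_ringEquiv (IsLocalization.algEquiv M A (Localization M)).toRingEquiv
  haveI hq : (Ideal.map (algebraMap R (Localization M)) (P.under R)).IsPrime :=
    IsLocalization.isPrime_of_isPrime_disjoint M _ _ inferInstance hdisj
  have hcomap : (Ideal.map (algebraMap R (Localization M)) (P.under R)).under R = P.under R :=
    IsLocalization.under_map_of_isPrime_disjoint M _ inferInstance hdisj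
  have hS : ((Ideal.map (algebraMap R (Localization M)) (P.under R)).under R).primeCompl =
      (P.under R).primeCompl := by
    ext x
    change x ∉ _ ↔ x ∉ _
    rw [hcomap]
  haveI : IsLocalization (P.under R).primeCompl
      (Localization.AtPrime (Ideal.map (algebraMap R (Localization M)) (P.under R))) := by
    have := IsLocalization.isLocalization_isLocalization_atPrime_isLocalization M
      (S := Localization M)
      (Localization.AtPrime (Ideal.map (algebraMap R (Localization M)) (P.under R)))
      (Ideal.map (algebraMap R (Localization M)) (P.under R))
    rw [← hS]
    exact this
  haveI : IsRegularLocalRing (Localization.AtPrime (P.under R)) :=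
    IsRegularLocalRing.of_ringEquiv
      (IsLocalization.algEquiv (P.under R).primeCompl
        (Localization.AtPrime (Ideal.map (algebraMap R (Localization M)) (P.under R)))
        (Localization.AtPrime (P.under R))).toRingEquiv
  exact isRegularLocalRing_localization_of_isUnramifiedAt (R := R) P

end EtaleRegular

/-! ### Zero products and localisations at a prime -/

section LocalDomain

variable {B : Type*} [CommRing B]

/-- If the localisation `B_P` is a domain, a zero product `ab = 0` in `B` has a factor killed by an
element outside `P`. [folklore] -/
lemma exists_mul_eq_zero_of_isDomain_localization (P : Ideal B) [P.IsPrime] (S : Type*)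
    [CommRing S] [Algebra B S] [IsLocalization.AtPrime S P] [IsDomain S] {a b : B}
    (hab : a * b = 0) : (∃ u ∉ P, u * a = 0) ∨ (∃ u ∉ P, u * b = 0) := by
  have h0 : algebraMap B S a * algebraMap B S b = 0 := by rw [← map_mul, hab, map_zero]
  rcases mul_eq_zero.mp h0 with h | h
  · left
    obtain ⟨⟨u, hu⟩, hu'⟩ := (IsLocalization.map_eq_zero_iff P.primeCompl S a).mp h
    exact ⟨u, hu, hu'⟩
  · right
    obtain ⟨⟨u, hu⟩, hu'⟩ := (IsLocalization.map_eq_zero_iff P.primeCompl S b).mp h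
    exact ⟨u, hu, hu'⟩

/-- Conversely, `B_P` has no zero divisors as soon as every zero product in `B` has a factor
killed by an element outside `P`. [folklore] -/
lemma noZeroDivisors_localization_of_forall_mul_eq_zero (P : Ideal B) [P.IsPrime] (S : Type*)
    [CommRing S] [Algebra B S] [IsLocalization.AtPrime S P]
    (key : ∀ a b : B, a * b = 0 → (∃ u ∉ P, u * a = 0) ∨ (∃ u ∉ P, u * b = 0)) :
    NoZeroDivisors S := by
  refine ⟨fun {x y} hxy => ?_⟩
  obtain ⟨⟨a, s⟩, rfl⟩ := IsLocalization.mk'_surjective P.primeCompl x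
  obtain ⟨⟨b, t⟩, rfl⟩ := IsLocalization.mk'_surjective P.primeCompl y
  rw [← IsLocalization.mk'_mul, IsLocalization.mk'_eq_zero_iff] at hxy
  obtain ⟨⟨m, hm⟩, hm'⟩ := hxy
  simp only [IsLocalization.mk'_eq_zero_iff]
  have hm'' : (m * a) * b = 0 := by rw [mul_assoc]; exact hm'
  rcases key (m * a) b hm'' with ⟨u, hu, hu'⟩ | ⟨u, hu, hu'⟩
  · left
    exact ⟨⟨u * m, Submonoid.mul_mem _ hu hm⟩, by simpa [mul_assoc] using hu'⟩
  · right
    exact ⟨⟨u, hu⟩, hu'⟩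

end LocalDomain

/-! ### Geometric generic fibres: `E ⊗_𝒪 R` is locally a domain when `R[1/p]` is regular -/

section GeometricFibre

variable (O : Type*) [CommRing O] (L : Type*) [Field L] [Algebra O L] (E : Type*) [Field E]
  [Algebra O E] [Algebra L E] [IsScalarTower O L E] (R : Type*) [CommRing R] [Algebra O R]

variable {O L E} in
/-- For `L'/L` finite inside `E`: `L'` is flat, formally unramified and essentially of finite type
over `𝒪` (`L = Frac 𝒪` of characteristic zero, so `L'/L` is separable). [folklore] -/
lemma flat_formallyUnramified_essFiniteType_intermediateField [IsFractionRing O L] [CharZero L]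
    (L' : IntermediateField L E) [FiniteDimensional L L'] :
    Module.Flat O L' ∧ Algebra.FormallyUnramified O L' ∧ Algebra.EssFiniteType O L' := by
  haveI : Module.Flat O L := IsLocalization.flat L (nonZeroDivisors O)
  haveI : Algebra.FormallyUnramified O L :=
    Algebra.FormallyUnramified.of_isLocalization (M := nonZeroDivisors O)
  haveI : Algebra.EssFiniteType O L := Algebra.EssFiniteType.of_isLocalization L (nonZeroDivisors O)
  haveI : Algebra.FormallyUnramified L L' := Algebra.FormallyUnramified.of_isSeparable L L'
  exact ⟨Module.Flat.trans O L L', Algebra.FormallyUnramified.comp O L L',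
    Algebra.EssFiniteType.comp O L L'⟩

variable {O L E R} in
/-- If `R` is noetherian and `R[1/o]` is regular (`o ∈ 𝒪` non-zero in `L = Frac 𝒪`, characteristic
zero), then `R ⊗_𝒪 L'` is a regular ring for every finite `L'/L` inside `E`: it is flat, formally
unramified and essentially of finite type over `R`, and `o` is a unit in it
(`isRegularRing_of_flat_of_formallyUnramified`). [cite: Matsumura1987, Thm. 23.7] -/
lemma isRegularRing_tensorProduct_intermediateField [IsFractionRing O L] [CharZero L]
    [IsNoetherianRing R] (o : O) (ho : algebraMap O L o ≠ 0) (A : Type*) [CommRing A] [Algebra R A]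
    [IsLocalization.Away (algebraMap O R o) A] [IsRegularRing A] (L' : IntermediateField L E)
    [FiniteDimensional L L'] : IsRegularRing (R ⊗[O] L') := by
  obtain ⟨h1, h2, h3⟩ := flat_formallyUnramified_essFiniteType_intermediateField (O := O) L'
  haveI : IsNoetherianRing (R ⊗[O] L') := Algebra.EssFiniteType.isNoetherianRing R _
  refine isRegularRing_of_flat_of_formallyUnramified (Submonoid.powers (algebraMap O R o)) A ?_
  intro m hm
  obtain ⟨k, rfl⟩ := hm
  rw [map_pow]
  refine IsUnit.pow k ?_
  have ho' : IsUnit (algebraMap O L' o) := by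
    refine Ne.isUnit fun h => ho ?_
    rwa [IsScalarTower.algebraMap_apply O L L', map_eq_zero] at h
  have : algebraMap R (R ⊗[O] L') (algebraMap O R o) =
      Algebra.TensorProduct.includeRight (algebraMap O L' o) := by
    rw [← IsScalarTower.algebraMap_apply, Algebra.TensorProduct.algebraMap_apply',
      Algebra.TensorProduct.includeRight_apply]
  rw [this]
  exact ho'.map _

/-- **`E ⊗_𝒪 R` is locally a domain.** Let `𝒪` be a commutative ring with fraction field `L` of
characteristic zero, `E/L` an algebraic field extension, `R` a noetherian `𝒪`-algebra such that
`R[1/o]` is a regular ring for some `o ∈ 𝒪` non-zero in `L`. Then the localisation of `E ⊗_𝒪 R`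
at every prime ideal `𝔐` is a domain: every finite subset of `E ⊗_𝒪 R` comes (injectively,
`r ⊗ c ↦ c ⊗ r`) from `R ⊗_𝒪 L'` for a finite subextension `L'/L` of `E`, each `R ⊗_𝒪 L'` is a
regular ring (`isRegularRing_tensorProduct_intermediateField`), and regular local rings are
domains, so zero products in `E ⊗_𝒪 R` have a factor killed outside `𝔐`. (The ring `E ⊗_𝒪 R`
itself is in general not noetherian.) [cite: BarnetlambEtAl2014, §1.4] -/
theorem isDomain_localization_atPrime_tensorProduct [IsFractionRing O L] [CharZero L]
    [Algebra.IsAlgebraic L E] [IsNoetherianRing R] (o : O) (ho : algebraMap O L o ≠ 0)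
    (A : Type*) [CommRing A] [Algebra R A] [IsLocalization.Away (algebraMap O R o) A]
    [IsRegularRing A] (𝔐 : Ideal (E ⊗[O] R)) [𝔐.IsPrime] :
    IsDomain (Localization.AtPrime 𝔐) := by
  classical
  -- the comparison maps `ι_{L'} : R ⊗ L' → E ⊗ R`, `r ⊗ c ↦ c ⊗ r`
  obtain ⟨ι, hι⟩ : ∃ ι : ∀ L' : IntermediateField L E, R ⊗[O] L' →ₐ[O] E ⊗[O] R,
      ∀ (L' : IntermediateField L E) (r : R) (c : L'), ι L' (r ⊗ₜ[O] c) = (c : E) ⊗ₜ[O] r :=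
    ⟨fun L' => Algebra.TensorProduct.productMap Algebra.TensorProduct.includeRight
        (Algebra.TensorProduct.includeLeft.comp ((IntermediateField.val L').restrictScalars O)),
      fun L' r c => by simp [Algebra.TensorProduct.productMap_apply_tmul]⟩
  -- each `ι_{L'}` is injective: `L' → E` is a split injection of `L`-vector spaces
  have hinj : ∀ L' : IntermediateField L E, Function.Injective (ι L') := by
    intro L'
    obtain ⟨ρ, hρ⟩ := LinearMap.exists_leftInverse_of_injective
      (IntermediateField.val L').toLinearMap
      (LinearMap.ker_eq_bot.mpr (IntermediateField.val L').toRingHom.injective)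
    let j : L' →ₗ[O] E := (IntermediateField.val L').toLinearMap.restrictScalars O
    let ρ' : E →ₗ[O] L' := ρ.restrictScalars O
    have hρ' : ρ'.comp j = LinearMap.id := by
      apply LinearMap.ext
      intro c
      exact LinearMap.congr_fun hρ c
    have hfac : (ι L').toLinearMap =
        (TensorProduct.comm O R E).toLinearMap.comp (TensorProduct.map LinearMap.id j) := by
      ext r c
      simp [hι, j]
    have hinj' : Function.Injective (TensorProduct.map (LinearMap.id : R →ₗ[O] R) j) := by
      refine Function.LeftInverse.injective (g := TensorProduct.map LinearMap.id ρ') fun x => ?_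
      rw [← LinearMap.comp_apply, ← TensorProduct.map_comp, hρ', LinearMap.comp_id,
        TensorProduct.map_id, LinearMap.id_apply]
    intro x y hxy
    have h' : (ι L').toLinearMap x = (ι L').toLinearMap y := hxy
    rw [hfac] at h'
    exact hinj' ((TensorProduct.comm O R E).injective h')
  -- every element of `E ⊗ R` is in the range of `ι_{L'}` for `L'` large enough
  have hrange : ∀ t : E ⊗[O] R, ∃ F : Finset E, ∀ L' : IntermediateField L E,
      (↑F : Set E) ⊆ L' → t ∈ Set.range (ι L') := by
    intro t
    induction t using TensorProduct.induction_on with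
    | zero => exact ⟨∅, fun L' _ => ⟨0, map_zero _⟩⟩
    | tmul c r =>
      refine ⟨{c}, fun L' h => ?_⟩
      have hc : c ∈ L' := h (by simp)
      exact ⟨r ⊗ₜ[O] ⟨c, hc⟩, by simp [hι]⟩
    | add x y hx hy =>
      obtain ⟨F₁, h₁⟩ := hx
      obtain ⟨F₂, h₂⟩ := hy
      refine ⟨F₁ ∪ F₂, fun L' h => ?_⟩
      obtain ⟨x', rfl⟩ := h₁ L' (subset_trans (by simp) h)
      obtain ⟨y', rfl⟩ := h₂ L' (subset_trans (by simp) h)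
      exact ⟨x' + y', map_add _ _ _⟩
  -- zero products in `E ⊗ R` have a factor killed by an element outside `𝔐`
  have key : ∀ a b : E ⊗[O] R, a * b = 0 →
      (∃ u ∉ 𝔐, u * a = 0) ∨ (∃ u ∉ 𝔐, u * b = 0) := by
    intro a b hab
    obtain ⟨Fa, hFa⟩ := hrange a
    obtain ⟨Fb, hFb⟩ := hrange b
    obtain ⟨L', hL'⟩ : ∃ L' : IntermediateField L E,
        L' = IntermediateField.adjoin L ↑(Fa ∪ Fb) := ⟨_, rfl⟩
    haveI : FiniteDimensional L L' := by
      rw [hL']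
      exact IntermediateField.finiteDimensional_adjoin
        fun x _ => (Algebra.IsAlgebraic.isAlgebraic x).isIntegral
    have hsub : (↑(Fa ∪ Fb) : Set E) ⊆ L' := by
      rw [hL']
      exact IntermediateField.subset_adjoin L _
    obtain ⟨a', rfl⟩ := hFa L' (subset_trans (by simp) hsub)
    obtain ⟨b', rfl⟩ := hFb L' (subset_trans (by simp) hsub)
    have hab' : a' * b' = 0 := hinj L' (by rw [map_mul, hab, map_zero])
    haveI : IsRegularRing (R ⊗[O] L') := isRegularRing_tensorProduct_intermediateField o ho A L'
    haveI : (𝔐.comap (ι L')).IsPrime := Ideal.comap_isPrime _ _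
    haveI := Literature.AlgebraicGeometry.Resolution.isDomain_of_isRegularLocalRing
      (Localization.AtPrime (𝔐.comap (ι L')))
    rcases exists_mul_eq_zero_of_isDomain_localization (𝔐.comap (ι L'))
        (Localization.AtPrime (𝔐.comap (ι L'))) hab' with ⟨u, hu, hu'⟩ | ⟨u, hu, hu'⟩
    · left
      refine ⟨ι L' u, hu, ?_⟩
      rw [← map_mul, hu', map_zero]
    · right
      refine ⟨ι L' u, hu, ?_⟩
      rw [← map_mul, hu', map_zero]
  haveI : NoZeroDivisors (Localization.AtPrime 𝔐) :=
    noZeroDivisors_localization_of_forall_mul_eq_zero 𝔐 (Localization.AtPrime 𝔐) key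
  exact NoZeroDivisors.to_isDomain _

end GeometricFibre

/-! ### Regular generic fibre ⇒ every point lies on a unique component -/

section PstConsequences

variable {K : Type} [Field K] [ValuativeRel K] [TopologicalSpace K] [IsNonarchimedeanLocalField K]
  {p : ℕ} [Fact p.Prime] {n : ℕ}

namespace PstWeilDeligneData

variable {𝔇 : PstWeilDeligneData K p}

/-- **Formally smooth generic fibre ⇒ every `ℚ̄_p`-point lies on a unique irreducible component**
([BLGGT] §1.4: "'Connects' is an equivalence relation. (Because `R^□_{𝒪,ρ̄,{H_τ},K'-cris}[1/l]`
is formally smooth.)"): `CrystallineGenericFibreRegular 𝔇` implies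
`CrystallinePointsOnUniqueComponent 𝔇`. Proof: `ℚ̄_p ⊗_{𝒪_L} R` is the union of the regular
rings `R ⊗_{𝒪_L} L' ≅ R[1/p] ⊗_L L'` (`L'/L` finite), so its local ring at the closed point
`ker x̄` is a domain and contains a unique minimal prime.
[cite: BarnetlambEtAl2014, §1.4] [cite: Kisin2007, Thm. 3.3.8] -/
theorem CrystallineGenericFibreRegular.crystallinePointsOnUniqueComponent
    (h : 𝔇.CrystallineGenericFibreRegular) : 𝔇.CrystallinePointsOnUniqueComponent := by
  intro L _ hL n
  letI := intermediateFieldIntegers.algebraPadicAlgCl L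
  letI : TopologicalSpace (ResidueField (intermediateFieldIntegers p L)) := ⊥
  intro ρbar v 𝓡 x
  haveI : IsRegularRing (Localization.Away (p : 𝓡.R)) := (h L hL n ρbar v 𝓡).1
  haveI : IsScalarTower (intermediateFieldIntegers p L) L (PadicAlgCl p) :=
    IsScalarTower.of_algebraMap_eq fun _ => rfl
  haveI : Algebra.IsAlgebraic L (PadicAlgCl p) := Algebra.IsAlgebraic.tower_top (K := ℚ_[p]) L
  haveI : IsLocalization.Away (algebraMap (intermediateFieldIntegers p L) 𝓡.R p)
      (Localization.Away (p : 𝓡.R)) := by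
    rw [map_natCast]
    infer_instance
  have hp0 : algebraMap (intermediateFieldIntegers p L) L p ≠ 0 := by
    rw [map_natCast]
    exact Nat.cast_ne_zero.mpr (Fact.out : p.Prime).ne_zero
  set 𝔐 := RingHom.ker (𝓡.pointQbar x) with h𝔐
  have hsurj : Function.Surjective (𝓡.pointQbar x) := fun c =>
    ⟨c ⊗ₜ 1, by rw [PointwiseLiftingRing.pointQbar_tmul, map_one, mul_one]⟩
  haveI : 𝔐.IsMaximal := RingHom.ker_isMaximal_of_surjective _ hsurj
  haveI : IsDomain (Localization.AtPrime 𝔐) :=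
    isDomain_localization_atPrime_tensorProduct (intermediateFieldIntegers p L) L (PadicAlgCl p)
      𝓡.R (p : intermediateFieldIntegers p L) hp0 (Localization.Away (p : 𝓡.R)) 𝔐
  obtain ⟨𝔮, h𝔮, hle⟩ :=
    Ideal.exists_minimalPrimes_le
      (I := (⊥ : Ideal (PadicAlgCl p ⊗[intermediateFieldIntegers p L] 𝓡.R))) (J := 𝔐) bot_le
  refine ⟨𝔮, ⟨h𝔮, hle⟩, fun 𝔮' h𝔮' => ?_⟩
  exact eq_of_mem_minimalPrimes_of_isDomain_localization 𝔐 h𝔮'.1 h𝔮 h𝔮'.2 hle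

end PstWeilDeligneData

/-- **The named fact reduces to its first four conjuncts.** By
`CrystallineGenericFibreRegular.crystallinePointsOnUniqueComponent`, a datum with
`UnramifiedWeightsZero`, `HasCrystallineDeformationRings`,
`HasHodgeTypeCrystallineDeformationRings` and `CrystallineGenericFibreRegular` (Kisin (2.7.7),
(3.3.3), Thm. (3.3.8)) automatically has `CrystallinePointsOnUniqueComponent` ([BLGGT] §1.4); so
`Kisin2007_crystallineDeformationRings` follows from the existence of the genuine datum with
Kisin's four properties. [cite: Kisin2007, Thm. 3.3.8] [cite: BarnetlambEtAl2014, §1.4] -/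
theorem kisin2007_crystallineDeformationRings_of_crystallineGenericFibreRegular
    (h : ∀ (K : Type) [Field K] [ValuativeRel K] [TopologicalSpace K] [IsNonarchimedeanLocalField K]
      (p : ℕ) [Fact p.Prime] [CharZero K] (_ : Algebra ℚ_[p] K),
      ∃ 𝔇 : PstWeilDeligneData K p, 𝔇.algebra = ‹Algebra ℚ_[p] K› ∧
        𝔇.UnramifiedWeightsZero ∧ 𝔇.HasCrystallineDeformationRings ∧
          𝔇.HasHodgeTypeCrystallineDeformationRings ∧ 𝔇.CrystallineGenericFibreRegular) :
    Kisin2007_crystallineDeformationRings := by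
  intro K _ _ _ _ p _ _ alg
  obtain ⟨𝔇, h𝔇, h0, h1, h2, h3⟩ := h K p alg
  exact ⟨𝔇, h𝔇, h0, h1, h2, h3, h3.crystallinePointsOnUniqueComponent⟩

end PstConsequences

end Literature.NumberTheory.GaloisRepresentations

end
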